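import Mathlib

/-!
# Solo (informed) rung s28/6: the W-line profile at the three `a₁ = 2` fields and the forced `j(C₁) = ℤ/7`

Setting (paper §16.12(h)(5), s28 extension; claims c299, c301, c302). For the unramified W-line of an
inert `w = 1` field with `a₁ = 2` the profile formula P54 reads, with `T^W = {1, 3, 5}`,
`V_k = 2 + 3⌈k/2⌉ - [k=5] + #{t ∈ T^W : t ≤ k+1, ℓ_t ≥ k+2-t} + [k=6] - [k=5]·ν_W - [k=0]`
(the `-[k=0]` is the transgression kill of the `ω¹`-map; the `+[k=6]` is the second `t = 1` socle map
`(t,i,k) = (1,6,6)` of the counting lemma, present exactly as in the ray-profile theorem (16.13)(j)(1)).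

* `soloInformed_wline_a1two_reading_generic`: the census vector `(2,5,6,8,9,10,12)` (fields `67733`,
  `471892`) has exactly the readings `(ℓ₁,ℓ₃,ℓ₅,ν_W) ∈ {(1,1,1,0), (1,1,2,1)}`;
* `soloInformed_wline_a1two_reading_445393`: `(2,5,6,9,9,10,12)` has exactly `{(1,2,1,0), (1,2,2,1)}`;
  in both cases `ℓ₁^W = 1` is forced (the `ω¹`-generator is G-fixed), and with `Cl(F_W)[7] = 0`
  (`ν_W = 0`, all three fields) the reading is unique.
* `soloInformed_wline_kappa_count`: the graded genus count of the UNRAMIFIED line —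
  `|M[X]| = |C|/7 = 7^{m+b₃+b₅+f}` (`|V₁| = 7^m`, `f` free ends) with `ker j ⊂ C[7]`
  (`a_t ≤ b_t + 1`, `1 ≤ m ≤ 2`) — says that exactly `κ = f + 1` of `C₁[7], C₃[7], C₅[7]`
  capitulate; `soloInformed_wline_jC1_generic` / `_445393`: at the census fields (`n = (1,1)`, `f = 2`;
  resp. `n₃ = 2` glued into `j(C₅)` so `b₅ = a₅ = 1`, `f = 1`) this forces `m = 1`, i.e.
  `j(C₁) ≅ ℤ/7` (P55; claims c302/c305). `soloInformed_wline_jC1_order` is the same arithmetic with the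
  relation `f = (a₃-b₃)+(a₅-b₅)` taken as a hypothesis (true at these fields; it is NOT a general law of
  the unramified line — c305).
-/

namespace Summit.Langlands.Langlands.Theorems

open Finset

/-- P54 for `T^W = {1,3,5}` (the `a₁ = 2` W-line), as a function of the strand lengths and `ν_W`;
the socle count is the counting lemma of (16.13)(i) — pairs `(t, i)`, `i ≡ t - 1 (mod 6)`, `i ≤ k`,
`ℓ_t ≥ k + 1 - i` — whose pair `(t, i, k) = (1, 6, 6)` is the `+[k=6][1 ∈ T^W]` term of the prose formula. -/
def soloInformedWProfileA1Two (ℓ₁ ℓ₃ ℓ₅ ν k : ℕ) : ℕ :=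
  2 + 3 * ((k + 1) / 2) - (if k = 5 then 1 else 0)
    + ((range (k + 1)).filter (fun i =>
        ((1 + i) % 6 = 1 ∧ k + 1 - i ≤ ℓ₁) ∨ ((1 + i) % 6 = 3 ∧ k + 1 - i ≤ ℓ₃)
          ∨ ((1 + i) % 6 = 5 ∧ k + 1 - i ≤ ℓ₅))).card
    - (if k = 5 then ν else 0) - (if k = 0 then 1 else 0)

/-- The census vector of the W-lines of `67733` and `471892`. -/
def soloInformedWVectorA (k : ℕ) : ℕ :=
  if k = 0 then 2 else if k = 1 then 5 else if k = 2 then 6 else if k = 3 then 8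
  else if k = 4 then 9 else if k = 5 then 10 else 12

/-- The census vector of the W-line of `445393`. -/
def soloInformedWVectorB (k : ℕ) : ℕ :=
  if k = 0 then 2 else if k = 1 then 5 else if k = 2 then 6 else if k = 3 then 9
  else if k = 4 then 9 else if k = 5 then 10 else 12

/-- The W-line census vector `(2,5,6,8,9,10,12)` of the `a₁ = 2` fields `67733`, `471892` has exactly the
P54 readings `(ℓ₁,ℓ₃,ℓ₅,ν_W) ∈ {(1,1,1,0), (1,1,2,1)}`; `ℓ₁^W = 1` is forced. -/
theorem soloInformed_wline_a1two_reading_generic :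
    ∀ ℓ₁ ∈ Icc 1 7, ∀ ℓ₃ ∈ Icc 1 7, ∀ ℓ₅ ∈ Icc 1 7, ∀ ν ≤ 1,
      (∀ k ≤ 6, soloInformedWProfileA1Two ℓ₁ ℓ₃ ℓ₅ ν k = soloInformedWVectorA k)
        ↔ (ℓ₁, ℓ₃, ℓ₅, ν) ∈ ({(1, 1, 1, 0), (1, 1, 2, 1)} : Finset (ℕ × ℕ × ℕ × ℕ)) := by
  decide

/-- The W-line census vector `(2,5,6,9,9,10,12)` of the `a₁ = 2` field `445393` has exactly the P54 readings
`(ℓ₁,ℓ₃,ℓ₅,ν_W) ∈ {(1,2,1,0), (1,2,2,1)}`; `ℓ₁^W = 1` and `ℓ₃^W = 2` are forced. -/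
theorem soloInformed_wline_a1two_reading_445393 :
    ∀ ℓ₁ ∈ Icc 1 7, ∀ ℓ₃ ∈ Icc 1 7, ∀ ℓ₅ ∈ Icc 1 7, ∀ ν ≤ 1,
      (∀ k ≤ 6, soloInformedWProfileA1Two ℓ₁ ℓ₃ ℓ₅ ν k = soloInformedWVectorB k)
        ↔ (ℓ₁, ℓ₃, ℓ₅, ν) ∈ ({(1, 2, 1, 0), (1, 2, 2, 1)} : Finset (ℕ × ℕ × ℕ × ℕ)) := by
  decide

/-- Arithmetic form used at the census fields: `m + b₃ + b₅ + f = a₃ + a₅ + 1` with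
`f = (a₃ - b₃) + (a₅ - b₅)` (a hypothesis, true at the three `a₁ = 2` fields), `bₜ ≤ aₜ`, `1 ≤ m`
gives `m = 1`. -/
theorem soloInformed_wline_jC1_order (a₃ a₅ b₃ b₅ f m : ℕ)
    (hb₃ : b₃ ≤ a₃) (hb₅ : b₅ ≤ a₅) (hf : f = (a₃ - b₃) + (a₅ - b₅)) (hm : 1 ≤ m)
    (hcount : m + b₃ + b₅ + f = a₃ + a₅ + 1) : m = 1 := by
  omega

/-- The genus count of the unramified W-line with `a₁ = 2`: `|M[X]| = |C|/7`, i.e.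
`m + b₃ + b₅ + f = a₃ + a₅ + 1`, with `ker j ⊂ C[7]` (`aₜ ≤ bₜ + 1`, `bₜ ≤ aₜ`, `1 ≤ m ≤ 2`) is equivalent to:
exactly `κ = f + 1` of the three groups `C₁[7], C₃[7], C₅[7]` capitulate. -/
theorem soloInformed_wline_kappa_count (a₃ a₅ b₃ b₅ f m : ℕ)
    (h₃ : b₃ ≤ a₃) (h₃' : a₃ ≤ b₃ + 1) (h₅ : b₅ ≤ a₅) (h₅' : a₅ ≤ b₅ + 1) (hm : 1 ≤ m) (hm' : m ≤ 2) :
    m + b₃ + b₅ + f = a₃ + a₅ + 1 ↔ (2 - m) + (a₃ - b₃) + (a₅ - b₅) = f + 1 := by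
  omega

/-- `67733/(1,5)`, `471892/(1,3)`: `a₃ = a₅ = 1`, `n = (1,1)` with two free ends (`f = 2`):
the count forces `m = 1` and `b₃ = b₅ = 0` (all of `C₁[7]`, `C₃`, `C₅` capitulate). -/
theorem soloInformed_wline_jC1_generic (b₃ b₅ m : ℕ) (hm : 1 ≤ m) (hm' : m ≤ 2)
    (hcount : m + b₃ + b₅ + 2 = 1 + 1 + 1) : m = 1 ∧ b₃ = 0 ∧ b₅ = 0 := by
  omega

/-- `445393/(1,0)`: `a₃ = a₅ = 1`, the 3-strand glued into `j(C₅)` (so `C₅` injects, `b₅ = 1`),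
one free end (`f = 1`): the count forces `m = 1` and `b₃ = 0`. -/
theorem soloInformed_wline_jC1_445393 (b₃ m : ℕ) (hm : 1 ≤ m) (hm' : m ≤ 2)
    (hcount : m + b₃ + 1 + 1 = 1 + 1 + 1) : m = 1 ∧ b₃ = 0 := by
  omega

end Summit.Langlands.Langlands.Theorems
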